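import Mathlib
import Summits.KontsevichZagierPeriods.Zeta5Search.Families.RayGrowth
import HarnessLib

/-!
# ζ(5) search — Families: monotonicity of the cellular integrals in the exponents

HONEST FRAMING: systematic search; no irrationality claim unless certified.  STRUCTURAL facts about Brown's generalised
cellular integrals `I_σ(a,b) = ∫_S ∏_i (z_i−z_{i+1})^{a_i} / ∏_i (z_{σ_i}−z_{σ_{i+1}})^{b_i} · ω_σ` [Brown2016, §1.5 (1.4),
§5.2 (5.4)] (seat P2, Families layer); nothing about the arithmetic of any zeta value.

Every edge factor on the open simplex lies in `(0,1]` (`ef_le_one`), so the integrand is ANTITONE in each numerator exponent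
and MONOTONE in each denominator exponent (`integrand_anti_num`, `integrand_mono_den`).  Consequences:
* `integrableOn_of_num_le` / `integrableOn_of_le_den` — integrability passes DOWN the order (raising numerator exponents or
  lowering denominator exponents preserves convergence), with no homogeneity assumption;
* **`integral_anti_num`** (`a ≤ a' ⇒ I_σ(a',b) ≤ I_σ(a,b)`), **`integral_mono_den`** (`b ≤ b' ⇒ I_σ(a,b) ≤ I_σ(a,b')`, given
  convergence of the larger one);
* for rays, the growth constants compare the same way: `raySup_anti_num`, `raySup_mono_den`.
Standard axioms only.
-/

noncomputable section

open MeasureTheory Set Finset Filter Topology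

namespace Summit.KontsevichZagierPeriods.Zeta5Search.Families.Cellular

variable {ℓ : ℕ} (σ : Fin (ℓ + 3) → Fin (ℓ + 3))

/-! ### Edge factors lie in `(0, 1]` -/

/-- On the open simplex every marked point satisfies `0 ≤ pt t k`. -/
theorem pt_nonneg {t : Fin ℓ → ℝ} (ht : t ∈ openSimplex ℓ) (k : ℕ) : 0 ≤ pt t k := by
  rcases Nat.eq_zero_or_pos k with rfl | hk
  · simp
  · by_cases hk' : k ≤ ℓ + 1
    · have := pt_lt_pt ht hk hk'
      rw [pt_zero] at this
      exact this.le
    · rw [pt_of_gt t (by omega)]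
      exact zero_le_one

/-- On the open simplex every marked point satisfies `pt t k ≤ 1`. -/
theorem pt_le_one {t : Fin ℓ → ℝ} (ht : t ∈ openSimplex ℓ) (k : ℕ) : pt t k ≤ 1 := by
  by_cases hk : k < ℓ + 1
  · have := pt_lt_pt ht hk le_rfl
    rw [pt_of_gt t le_rfl] at this
    exact this.le
  · rw [pt_of_gt t (by omega)]

/-- **Every edge factor is at most `1` on the open simplex.** -/
theorem ef_le_one {t : Fin ℓ → ℝ} (ht : t ∈ openSimplex ℓ) (u v : Fin (ℓ + 3)) : ef t u v ≤ 1 := by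
  unfold ef
  split_ifs
  · exact le_rfl
  · linarith [pt_le_one ht (max u.val v.val), pt_nonneg ht (min u.val v.val)]

/-- Powers of an edge factor decrease with the exponent: `m ≤ n ⇒ ef^n ≤ ef^m` (distinct vertices). -/
theorem ef_zpow_anti {t : Fin ℓ → ℝ} (ht : t ∈ openSimplex ℓ) {u v : Fin (ℓ + 3)} (huv : u ≠ v) {m n : ℤ}
    (hmn : m ≤ n) : ef t u v ^ n ≤ ef t u v ^ m :=
  zpow_le_zpow_right_of_le_one₀ (ef_pos ht huv) (ef_le_one ht u v) hmn

/-! ### Pointwise monotonicity of the integrand -/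

/-- The numerator is antitone in the exponents. -/
theorem num_anti {t : Fin ℓ → ℝ} (ht : t ∈ openSimplex ℓ) {a a' : Fin (ℓ + 3) → ℤ} (h : a ≤ a') :
    num a' t ≤ num a t :=
  Finset.prod_le_prod (fun i _ => (zpow_pos (ef_pos ht (succ_ne_self i)) _).le)
    fun i _ => ef_zpow_anti ht (succ_ne_self i) (h i)

/-- The denominator is antitone in the exponents (injective `σ`). -/
theorem den_anti (hσi : Function.Injective σ) {t : Fin ℓ → ℝ} (ht : t ∈ openSimplex ℓ) {b b' : Fin (ℓ + 3) → ℤ}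
    (h : b ≤ b') : den σ b' t ≤ den σ b t :=
  Finset.prod_le_prod (fun i _ => (zpow_pos (ef_pos ht fun e => succ_ne_self i (hσi e)) _).le)
    fun i _ => ef_zpow_anti ht (fun e => succ_ne_self i (hσi e)) (h i)

/-- **The integrand is antitone in the numerator exponents**: `a ≤ a' ⇒ f_σ(a',b)ω_σ ≤ f_σ(a,b)ω_σ`. -/
theorem integrand_anti_num (hσi : Function.Injective σ) {t : Fin ℓ → ℝ} (ht : t ∈ openSimplex ℓ)
    {a a' : Fin (ℓ + 3) → ℤ} (h : a ≤ a') (b : Fin (ℓ + 3) → ℤ) : integrand σ a' b t ≤ integrand σ a b t := by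
  have hden : 0 < den σ b t := Finset.prod_pos fun i _ => zpow_pos (ef_pos ht fun e => succ_ne_self i (hσi e)) _
  have hfd : 0 < formDen σ t := Finset.prod_pos fun i _ => ef_pos ht fun e => succ_ne_self i (hσi e)
  unfold integrand
  exact div_le_div_of_nonneg_right (div_le_div_of_nonneg_right (num_anti ht h) hden.le) hfd.le

/-- **The integrand is monotone in the denominator exponents**: `b ≤ b' ⇒ f_σ(a,b)ω_σ ≤ f_σ(a,b')ω_σ`. -/
theorem integrand_mono_den (hσi : Function.Injective σ) {t : Fin ℓ → ℝ} (ht : t ∈ openSimplex ℓ)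
    (a : Fin (ℓ + 3) → ℤ) {b b' : Fin (ℓ + 3) → ℤ} (h : b ≤ b') : integrand σ a b t ≤ integrand σ a b' t := by
  have hnum : 0 < num a t := Finset.prod_pos fun i _ => zpow_pos (ef_pos ht (succ_ne_self i)) _
  have hden' : 0 < den σ b' t := Finset.prod_pos fun i _ => zpow_pos (ef_pos ht fun e => succ_ne_self i (hσi e)) _
  have hfd : 0 < formDen σ t := Finset.prod_pos fun i _ => ef_pos ht fun e => succ_ne_self i (hσi e)
  unfold integrand
  exact div_le_div_of_nonneg_right (div_le_div_of_nonneg_left hnum.le hden' (den_anti σ hσi ht h)) hfd.le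

/-! ### Measurability and transfer of integrability -/

/-- The integrand is continuous on the open simplex (injective `σ`). -/
theorem continuousOn_integrand (hσi : Function.Injective σ) (a b : Fin (ℓ + 3) → ℤ) :
    ContinuousOn (integrand σ a b) (openSimplex ℓ) := by
  have h := (continuousOn_rayF σ a b hσi).mul
    ((continuous_const.continuousOn).div (continuous_formDen σ).continuousOn fun t ht =>
      (Finset.prod_pos fun i _ => ef_pos ht fun e => succ_ne_self i (hσi e)).ne' :
      ContinuousOn (fun t => (1 : ℝ) / formDen σ t) (openSimplex ℓ))
  refine h.congr fun t _ => ?_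
  rw [integrand_eq_rayF_mul]
  unfold basic integrand
  simp [num, den]

/-- Integrability passes to LARGER numerator exponents (domination by `ef ≤ 1`). -/
theorem integrableOn_of_num_le (hσi : Function.Injective σ) {a a' : Fin (ℓ + 3) → ℤ} (h : a ≤ a')
    (b : Fin (ℓ + 3) → ℤ) (hint : IntegrableOn (integrand σ a b) (openSimplex ℓ)) :
    IntegrableOn (integrand σ a' b) (openSimplex ℓ) := by
  refine Integrable.mono' hint
    ((continuousOn_integrand σ hσi a' b).aestronglyMeasurable (measurableSet_openSimplex ℓ)) ?_
  refine (ae_restrict_iff' (measurableSet_openSimplex ℓ)).2 (ae_of_all _ fun t ht => ?_)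
  rw [Real.norm_eq_abs, abs_of_pos (integrand_pos hσi _ _ ht)]
  exact integrand_anti_num σ hσi ht h b

/-- Integrability passes to SMALLER denominator exponents. -/
theorem integrableOn_of_le_den (hσi : Function.Injective σ) (a : Fin (ℓ + 3) → ℤ) {b b' : Fin (ℓ + 3) → ℤ}
    (h : b ≤ b') (hint : IntegrableOn (integrand σ a b') (openSimplex ℓ)) :
    IntegrableOn (integrand σ a b) (openSimplex ℓ) := by
  refine Integrable.mono' hint
    ((continuousOn_integrand σ hσi a b).aestronglyMeasurable (measurableSet_openSimplex ℓ)) ?_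
  refine (ae_restrict_iff' (measurableSet_openSimplex ℓ)).2 (ae_of_all _ fun t ht => ?_)
  rw [Real.norm_eq_abs, abs_of_pos (integrand_pos hσi _ _ ht)]
  exact integrand_mono_den σ hσi ht a h

/-! ### Monotonicity of the integrals -/

/-- **`a ≤ a' ⇒ I_σ(a',b) ≤ I_σ(a,b)`** (when `I_σ(a,b)` converges; then so does `I_σ(a',b)`). -/
theorem integral_anti_num (hσi : Function.Injective σ) {a a' : Fin (ℓ + 3) → ℤ} (h : a ≤ a') (b : Fin (ℓ + 3) → ℤ)
    (hint : IntegrableOn (integrand σ a b) (openSimplex ℓ)) : integral σ a' b ≤ integral σ a b :=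
  setIntegral_mono_on (integrableOn_of_num_le σ hσi h b hint) hint (measurableSet_openSimplex ℓ)
    fun _ ht => integrand_anti_num σ hσi ht h b

/-- **`b ≤ b' ⇒ I_σ(a,b) ≤ I_σ(a,b')`** (when `I_σ(a,b')` converges; then so does `I_σ(a,b)`). -/
theorem integral_mono_den (hσi : Function.Injective σ) (a : Fin (ℓ + 3) → ℤ) {b b' : Fin (ℓ + 3) → ℤ} (h : b ≤ b')
    (hint : IntegrableOn (integrand σ a b') (openSimplex ℓ)) : integral σ a b ≤ integral σ a b' :=
  setIntegral_mono_on (integrableOn_of_le_den σ hσi a h hint) hint (measurableSet_openSimplex ℓ)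
    fun _ ht => integrand_mono_den σ hσi ht a h

/-! ### Monotonicity of the growth constants of rays -/

/-- `f_σ(α',β) ≤ f_σ(α,β)` on the simplex for `α ≤ α'`. -/
theorem rayF_anti_num (hσi : Function.Injective σ) {t : Fin ℓ → ℝ} (ht : t ∈ openSimplex ℓ)
    {α α' : Fin (ℓ + 3) → ℤ} (h : α ≤ α') (β : Fin (ℓ + 3) → ℤ) : rayF σ α' β t ≤ rayF σ α β t := by
  have hden : 0 < den σ β t := Finset.prod_pos fun i _ => zpow_pos (ef_pos ht fun e => succ_ne_self i (hσi e)) _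
  unfold rayF
  exact div_le_div_of_nonneg_right (num_anti ht h) hden.le

/-- `f_σ(α,β) ≤ f_σ(α,β')` on the simplex for `β ≤ β'`. -/
theorem rayF_mono_den (hσi : Function.Injective σ) {t : Fin ℓ → ℝ} (ht : t ∈ openSimplex ℓ)
    (α : Fin (ℓ + 3) → ℤ) {β β' : Fin (ℓ + 3) → ℤ} (h : β ≤ β') : rayF σ α β t ≤ rayF σ α β' t := by
  have hnum : 0 < num α t := Finset.prod_pos fun i _ => zpow_pos (ef_pos ht (succ_ne_self i)) _
  have hden' : 0 < den σ β' t := Finset.prod_pos fun i _ => zpow_pos (ef_pos ht fun e => succ_ne_self i (hσi e)) _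
  unfold rayF
  exact div_le_div_of_nonneg_left hnum.le hden' (den_anti σ hσi ht h)

/-- **`α ≤ α' ⇒ M_σ(α',β) ≤ M_σ(α,β)`** (when `f_σ(α,β)` is bounded on the simplex). -/
theorem raySup_anti_num (hσi : Function.Injective σ) {α α' : Fin (ℓ + 3) → ℤ} (h : α ≤ α') (β : Fin (ℓ + 3) → ℤ)
    (hbdd : BddAbove (rayF σ α β '' openSimplex ℓ)) : raySup σ α' β ≤ raySup σ α β :=
  csSup_le ((openSimplex_nonempty ℓ).image _) (by
    rintro _ ⟨t, ht, rfl⟩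
    exact (rayF_anti_num σ hσi ht h β).trans (le_csSup hbdd ⟨t, ht, rfl⟩))

/-- **`β ≤ β' ⇒ M_σ(α,β) ≤ M_σ(α,β')`** (when `f_σ(α,β')` is bounded on the simplex). -/
theorem raySup_mono_den (hσi : Function.Injective σ) (α : Fin (ℓ + 3) → ℤ) {β β' : Fin (ℓ + 3) → ℤ} (h : β ≤ β')
    (hbdd : BddAbove (rayF σ α β' '' openSimplex ℓ)) : raySup σ α β ≤ raySup σ α β' :=
  csSup_le ((openSimplex_nonempty ℓ).image _) (by
    rintro _ ⟨t, ht, rfl⟩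
    exact (rayF_mono_den σ hσi ht α h).trans (le_csSup hbdd ⟨t, ht, rfl⟩))

end Summit.KontsevichZagierPeriods.Zeta5Search.Families.Cellular
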